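import Summits.QuantumFields.YangMills.Theorems.BalabanUVNodesN06GDSupSubLegAtPinsPUWI
import Summits.QuantumFields.YangMills.Theorems.BalabanUVNodesN06StateLayerAtPinsPUWPar
import Summits.QuantumFields.YangMills.Theorems.BalabanUVNodesN06GDSupLegAtPinsPUW
import Literature.MathematicalPhysics.QuantumFieldTheory.Balaban1983to89.B9Eq3132FromStateR

/-!
# CASCADE-K PIECE K2 (director-ym №383) — THE SITE-TRANSPORTER-PARAMETRIC RE-PRESS of `N06GDSupSubLegAtPinsPUWI`: `gdsup_sub_of_pins_inv_par` = the landed `gdsup_sub_of_pins_inv` VERBATIM with the record's symmetric transporter `parSymY x.toKIdx` replaced by a PARAMETER `parT : ∀ i, SiteParY _ i` (every `GpY ∕ GpPhysY ∕ PcoK ∕ TaLcoK …` letter read at `parT x.toKIdx`; proofs verbatim — the callees were already transporter-generic); at `parT := parSymY` they ARE the originals, at `parT := parKnitY` they serve the knit certificate's Sect.-D network «K3-D» (dag-n06-d g25, `K3D-CENSUS-g25.md`).  Seat `pub-ymgap-dag-n06-d` (g25), 2026-08-30.  The original module text below applies word for word otherwise.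
#

# N06 [B9] — THE TWO (2.51) ENTRIES OF THE SECT.-D PROPAGATOR: `G_D(U)` (scaled sup letter) AND `G_D(U) − G₀(U)` (with its small factor) FROM THE Δ⁽²⁾-FREE RESOLVENT IDENTITIES
# (programme P-D2, leg F-A⁗, cut 1 of dag-n06-d's ⚑ LOCATED-D2-CYCLE-2: the inputs of ROW 26's coercivity transfer for `(QG̃Q*)⁻¹` BEFORE the certificate's L² step)

T. Bałaban, *Propagators for lattice gauge theories in a background field*, Commun. Math. Phys. **99** (1985) 389–434 [`Balaban1985BackgroundPropagators`], Thm 3.12 (3.130) p. 421,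
(3.132) p. 422, p. 423, (3.42) p. 397; [4] = T. Bałaban, *Propagators and renormalization transformations for lattice gauge theories. II*, Commun. Math. Phys. **96** (1984)
223–250 [`Balaban1984PropagatorsII`], (2.51)–(2.56) pp. 232–233, Lemma 2.1 (2.60)–(2.61) p. 234.

WHY (cell `pub-ymgap`, node N06, bundle F7 rows 20–21, seat dag-n06-l g33).  dag-n06-d's LOCATED-D2-CYCLE-2: the (3.132) class letter of `C = (QG̃Q*)⁻¹` that the (3.137)
prechain consumed (`…N06D2SupPrechainAtPinsPUW`, binder `hc2`) is, in the certificate, read off ROW 26 — itself derived from the TRUE state layer and `Identities`, downstream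
of `hD2sup`.  Print derives (3.132) for `(QG̃Q*)⁻¹` from G̃'s (3.130) ALONE; in the tree that road is ROW 26's coercivity ∕ decay transfer
(`B9Eq3132CoerciveFromGAR.coerciveUnder_of_subMajorants_R`, `B9Eq3132FacesAtLettersR.hdec26_of_majorants_of_R`), whose inputs are the two [4]-(2.51) entries of
`G̃ = G_D` and `G_D − G₀` (the latter with the small factor `Mα₀`).  THIS FILE supplies both, Δ⁽²⁾-free: it is `…N06GDSupSqLegAtPinsPUWI.gdsup_sq_of_pins_inv` (PASS 1:
the U8 state layer at the flat residual ⟹ 𝔖₂-tuple ⟹ `entry0_of_stepS_resolvent`) with ONE MORE conjunct — the `G − G₀ = (G₀Δ′_π)∘G` half of n06-d g18's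
`B9Eq3132FromStateR.hasMajorant_entries_of_stepS` (step inside 𝔖, `hasMaj_comp_exp`; reading `hasMaj_read_of_state`; raw shape `hasMajorant_of_read`), which reads the
identities ONLY through `G₀Δ_a = 1`, `(Δ_a − Δ′_π)G = 1`.  ★★★ `gdsup_sub_of_pins_inv`: binders = `gdsup_sq_of_pins_inv`'s VERBATIM; output `∃ MG aG rG rG', 0 < aG ≤ a₀ ∧
0 ≤ rG ∧ 0 ≤ rG' ∧ ∀ x, MG ≤ M → ∀ α₀ > 0, Mα₀ ≤ aG → ∀ U ∈ (3.35) ∩ (3.36), HasMajorant blk (G U) (rG·(Lʲη)_a²·e^{−ρ_G d}) ∧ HasMajorant blk (G U − G₀ U)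
(rG'·(Mα₀)·(Lʲη)_a²·e^{−ρ_G d})`.
HONEST LABEL: helper (composition of landed faces by name), count-neutral; N06 NOT discharged; nothing continuum ∕ OS ∕ mass gap ∕ Clay.  NEW file; nothing landed is modified.
-/

noncomputable section

namespace Summit.QuantumFields.YangMills.BalabanUVNodes.N06GDSupSubLegAtPinsPUWIPar

open Literature.MathematicalPhysics.QuantumFieldTheory.Balaban1983to89
open Literature.MathematicalPhysics.QuantumFieldTheory.Balaban1983to89.Node00 (FBondY IBondY SiteY CfgY SiteParY SiteOpY parSymY GpY GpPhysY BondOpY parBY BondParY)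
open Literature.MathematicalPhysics.QuantumFieldTheory.Balaban1983to89.Node00.OpsYSectDCoords (DvcoKH DvscoKH TpicoK T2coK cR39_trBasis_pos)
open B9Thm39ReadingCoords (cR39 coordBound39 basisBound39)
open B9Thm34Ext (toB6)
open B11SectG (HasMaj BlockNorm)
open B9Thm312Whole (cNorm GeoOK)
open B9Thm312WholeClasses (cNormR rwt rwt_nonneg)
open B9CoReadingCoords (XBK blkBK coordOpK cdBₗ)
open B9CoReadingCoordsS (XSK sIK blkSK GcoS)
open B9CoReadingCoordsH (XHK)
open B9CoReadingCoordsTranspose (TrIdx trBasis)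
open B9PinMembersKLevelV1 (MemberY geo9Y)
open B9BackgroundsKLevelV1R (RegFamY bg9YR MemOfFam)
open B9GeoLemma21KLevelV1 (geo9Y_len_pos geo9Y_dist_triangle geo9Y_dist_comm)
open B9GeoNormsKLevelV1 (geo9K geo9K_dist_nonneg)
open B7Prop2SpecialUnitary (specialUnitaryUnits)
open B9PerturbationMajorantAlgebra (Proj349Maj Thm31GpMaj hasMaj_weaken)
open B9PerturbationMajorantsAtLetters (PcoK)
open B9MultiscaleSmoothPartitionYNear (rNear)
open B9MultiscaleSmoothPartitionYLip (CLip CLip_nonneg)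
open B9SmoothHolderClassP (bHZKP bHZKPG bHZPG)
open B9GradViaDivLettersTransported (taxiB taxiS)
open B9PerturbationSplitAtLetters (TaLcoK TbLcoKH Ta2LcoK Tb2LcoKH)
open B9PerturbationL2Delta2 (D2coK)
open B9SmoothHolderClassPProducers (CTel CTel_nonneg)
open B9RowSum261DefiniteFaces (rowConst261 rowConst261_nonneg)
open B9SectDSup (weightNorm)
open B6RandomWalk (HasMajorant)
open B6RandomWalkHom (HasMajorantHom)
open B9Thm312WholeStepRegular (StepS LettersS3131)
open B9CoReadingCoordsHolder (PK)
open B9CoReadingCoordsHolderAdm (holderProbesKA)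
open B9RWSums343Holder (HolderProbes)
open B9PerturbationMajorantAlgebra (CurrentMaj)
open B9PerturbationMajorantsAtLetters (BcoKH BdcoKH)
open B9Thm313WholeDir (Thm33G0DirR)
open B9Thm313WholeDirInputBC (Letters313IML)
open B9LettersHZAtOne (plateau_pos)
open B9CoReadingCoordsInput (bHK) open B9CoReadingCoordsInputS (bHS)
open B9CoRealizesRelAtLetters (RelB)
open B9Thm33G0ProbeZeroAtCutPins (pX0_of_pins)
open B6GlobalChartV1 (blkV1) open B6Ineq2142KLevelV1 (β lvl) open B6Geom246MultiLevelTorus (geomT)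
open Summit.QuantumFields.YangMills.BalabanUVNodes.N06HolderPinsGradedAtRecord (links_le_one)
open Summit.QuantumFields.YangMills.BalabanUVNodes.N06TbHLegAtPinsPhysPU (htbH_of_pinsP43_geo9Y)
open Summit.QuantumFields.YangMills.BalabanUVNodes.N06LettersSAtPinsPU (hLettersS_of_pinsP44_geo9Y)
open Summit.QuantumFields.YangMills.BalabanUVNodes.N06StateClassFactsAtPinsPU (hStateFacts_of_pinsP_geo9Y)
open Summit.QuantumFields.YangMills.BalabanUVNodes.N06StateProducerG0AtPinsPU (hG0S2_of_pinsP_geo9Y)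
open Summit.QuantumFields.YangMills.BalabanUVNodes.N06StateProducersAAtPinsPU (hProducersA_of_pinsP_geo9Y)
open Summit.QuantumFields.YangMills.BalabanUVNodes.N06StateProducersBAtPinsPUW (hProducersBW_of_pinsP_geo9Y)
open Summit.QuantumFields.YangMills.BalabanUVNodes.N06StatePairsAtPinsPU (hStatePairs_of_pinsP_geo9Y)
open Summit.QuantumFields.YangMills.BalabanUVNodes.N06StateAssemblyAtPinsPUW (hStateAssemblyW_of_faces)
open scoped Matrix.Norms.L2Operator
open Summit.QuantumFields.YangMills.BalabanUVNodes.N06StateLayerAtPinsPUW (hStateTuplesW_of_pinsP_geo9Y)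
open B9Thm312WholeEntry0Regular (entry0_of_stepS_resolvent)
open B9Thm312WholeLeaf (fix_of_inverses)
open B9Thm312WholeStepRegular (exists_hasMaj_const_of_dom hasMaj_right_of_stepS hasMaj_read_of_state)
open B11SectG (hasMaj_comp_exp)
open B6RandomWalk (hasMajorant_mono Triangle254)
open B9Eq3132FromStateR (hasMajorant_of_read)
open B9Ineq349SiteComposite (lenB lenB_eq)
open Literature.MathematicalPhysics.QuantumFieldTheory.Balaban1983to89.Node00 (etaS)
open B9Ineq349SiteFromBlocks (geo9Y_len_eq_lenB etaS_eq_abs_cf_inv)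
open B6Ineq2142KLevelV1 (lvl_le beta_level)
open B9RowSum261DefiniteFaces (rowConst261_spec_of_rowSum261)
open B9GeoLemma21KLevelV1 (rowSum261_geo9Y)
open B11SectG (RowSum)
open B6RandomWalk (hasMajorant_mono hasMajorant_zero)
open B9CoReadingCoords (coordOpK_apply)
open B9SectDSup (weightNorm_κ)

variable {N : ℕ} {d ℓ : ℕ} {hd : 1 ≤ d + 1} {hL : Odd (ℓ + 1) ∧ 1 < ℓ + 1} {b₀ b₁ : ℝ} {Mstar : ℕ}

open Summit.QuantumFields.YangMills.BalabanUVNodes.N06GDSupLegAtPinsPUW (hasMajorant_D2coK_zero)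

set_option maxHeartbeats 3200000 in
/-- ★★★ **THE TWO (2.51) ENTRIES `G_D(U)` AND `G_D(U) − G₀(U)` AT THE PINS FROM THE TWO Δ⁽²⁾-FREE RESOLVENT IDENTITIES** (module docstring):
`gdsup_sq_of_pins_inv`'s letter `rG·(Lʲη)_a²·e^{−ρ_G d}` for `G U` AND `rG'·(Mα₀)·(Lʲη)_a²·e^{−ρ_G d}` for `G U − G₀ U`, same regime `(MG, aG)`.
[cite: Balaban1985BackgroundPropagators, Thm 3.12 (3.130) p.421 + (3.132) p.422 + (3.42) p.397; Balaban1984PropagatorsII, (2.51)–(2.56) pp.232–233 + Lemma 2.1 (2.60)–(2.61) p.234] -/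
theorem gdsup_sub_of_pins_inv_par
    (parT : ∀ i : B6KLevelCensusIndexV1.KIdx d ℓ hd hL b₀ b₁, Node00.SiteParY (Matrix (Fin N) (Fin N) ℂ) i) [NeZero N] [∀ x : MemberY d ℓ hd hL b₀ b₁ Mstar, Fintype (geo9Y x).Site] [∀ x : MemberY d ℓ hd hL b₀ b₁ Mstar, DecidableRel (RelB x.toKIdx)]
    {R₁ R₂ : RegFamY d ℓ hd hL b₀ b₁ Mstar (Matrix (Fin N) (Fin N) ℂ)} (H : MemberY d ℓ hd hL b₀ b₁ Mstar → Prop)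
    (bI : ∀ x : MemberY d ℓ hd hL b₀ b₁ Mstar, FBondY x.toKIdx → IBondY x.toKIdx)
    (hlev : ∀ (x : MemberY d ℓ hd hL b₀ b₁ Mstar) (f : FBondY x.toKIdx), lvl x.hN x.D x.hk (bI x f) = (blkV1 x.hN x.D f).1.1)
    (hβ1 : ∀ (x : MemberY d ℓ hd hL b₀ b₁ Mstar) (f : FBondY x.toKIdx), (geomT x.D).dist (β x.hN x.D x.hk (bI x f)) (blkV1 x.hN x.D f) ≤ 1)
    (hbI0 : ∀ (x : MemberY d ℓ hd hL b₀ b₁ Mstar) (f : FBondY x.toKIdx), bI x f = bI x ⟨f.src, 0⟩)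
    (hGR : MemOfFam (specialUnitaryUnits (Fin N)) R₁)
    (c : ℝ) {M₀ a₀ : ℝ} (hM₀ : 0 ≤ M₀) {σ τ : ℝ} (hσ : 0 < σ) (hτ : 0 < τ)
    (w13 : ℝ → ℝ) (hw13₀ : ∀ s, 0 ≤ w13 s) (hw13₁ : ∀ s, w13 s ≤ 1) (wX : ℝ → ℝ) (hwX₀ : ∀ s, 0 ≤ wX s) (hwX₁ : ∀ s, wX s ≤ 1)
    {s44 : ℝ} (hs440 : 0 < s44) (hs441 : s44 < 1) (hw1344 : 0 < w13 s44) (hwX44 : 0 < wX s44)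
    (bH13 : ∀ x : MemberY d ℓ hd hL b₀ b₁ Mstar, (bg9YR (Matrix (Fin N) (Fin N) ℂ) (specialUnitaryUnits (Fin N)) R₁ R₂ x).Cfg → BlockNorm (toB6 (geo9Y x) 1 (H x)) (XSK (TrIdx N) x.toKIdx → ℝ))
    (hbH13 : ∀ (x : MemberY d ℓ hd hL b₀ b₁ Mstar) (U : (bg9YR (Matrix (Fin N) (Fin N) ℂ) (specialUnitaryUnits (Fin N)) R₁ R₂ x).Cfg), bH13 x U =
      letI : Fintype (geo9K x.toKIdx).Site := (inferInstance : Fintype (geo9Y x).Site);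
      bHZPG (κ := TrIdx N) x.toKIdx (trBasis N) (taxiS x.toKIdx (bg9YR (Matrix (Fin N) (Fin N) ℂ) (specialUnitaryUnits (Fin N)) R₁ R₂ x) (fun U => U) U) (R := (1 : ℝ)) (H := H x) w13 hw13₀ hw13₁)
    (hκ13 : ∀ (x : MemberY d ℓ hd hL b₀ b₁ Mstar) (U : (bg9YR (Matrix (Fin N) (Fin N) ℂ) (specialUnitaryUnits (Fin N)) R₁ R₂ x).Cfg), (bH13 x U).κ ≤ 1 + CLip d ℓ)
    (bXH : ∀ x : MemberY d ℓ hd hL b₀ b₁ Mstar, (bg9YR (Matrix (Fin N) (Fin N) ℂ) (specialUnitaryUnits (Fin N)) R₁ R₂ x).Cfg → BlockNorm (toB6 (geo9Y x) 1 (H x)) (XBK (TrIdx N) x.toKIdx → ℝ))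
    (hbXH : ∀ (x : MemberY d ℓ hd hL b₀ b₁ Mstar) (U : (bg9YR (Matrix (Fin N) (Fin N) ℂ) (specialUnitaryUnits (Fin N)) R₁ R₂ x).Cfg), bXH x U =
      letI : Fintype (geo9K x.toKIdx).Site := (inferInstance : Fintype (geo9Y x).Site);
      bHZKPG (κ := TrIdx N) x.toKIdx (trBasis N) (taxiB x.toKIdx (bg9YR (Matrix (Fin N) (Fin N) ℂ) (specialUnitaryUnits (Fin N)) R₁ R₂ x) (fun U => U) U) (R := (1 : ℝ)) (H := H x) wX hwX₀ hwX₁)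
    (bHXA : ∀ x : MemberY d ℓ hd hL b₀ b₁ Mstar, ℝ → BlockNorm (toB6 (geo9Y x) 1 (H x)) (XBK (TrIdx N) x.toKIdx → ℝ))
    (hbHXA : ∀ x : MemberY d ℓ hd hL b₀ b₁ Mstar, bHXA x = fun ε => letI : Fintype (geo9K x.toKIdx).Site := (inferInstance : Fintype (geo9Y x).Site); bHK x.toKIdx (bI x) ε)
    (bW : ∀ x : MemberY d ℓ hd hL b₀ b₁ Mstar, (bg9YR (Matrix (Fin N) (Fin N) ℂ) (specialUnitaryUnits (Fin N)) R₁ R₂ x).Cfg → ℝ → BlockNorm (toB6 (geo9Y x) 1 (H x)) (XSK (TrIdx N) x.toKIdx → ℝ))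
    (𝔬12 : ∀ x : MemberY d ℓ hd hL b₀ b₁ Mstar, B9Thm312Whole.Ops (geo9Y x) (bg9YR (Matrix (Fin N) (Fin N) ℂ) (specialUnitaryUnits (Fin N)) R₁ R₂ x) (XBK (TrIdx N) x.toKIdx) (XBK (TrIdx N) x.toKIdx) (XHK (TrIdx N) x.toKIdx) (XSK (TrIdx N) x.toKIdx))
    (hblk12 : ∀ x : MemberY d ℓ hd hL b₀ b₁ Mstar, (𝔬12 x).blk = blkBK x.toKIdx (bI x))
    (hblkW12 : ∀ x : MemberY d ℓ hd hL b₀ b₁ Mstar, (𝔬12 x).blkW = blkSK x.toKIdx (sIK x.toKIdx (bI x)))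
    (hTpico12 : ∀ (x : MemberY d ℓ hd hL b₀ b₁ Mstar) (U : (bg9YR (Matrix (Fin N) (Fin N) ℂ) (specialUnitaryUnits (Fin N)) R₁ R₂ x).Cfg), (𝔬12 x).Tpi U = TpicoK x.toKIdx (trBasis N) (bg9YR (Matrix (Fin N) (Fin N) ℂ) (specialUnitaryUnits (Fin N)) R₁ R₂ x) (fun U => U) (parT x.toKIdx) (GpPhysY x.toKIdx (parT x.toKIdx)) U)
    (hDvco12 : ∀ (x : MemberY d ℓ hd hL b₀ b₁ Mstar) (U : (bg9YR (Matrix (Fin N) (Fin N) ℂ) (specialUnitaryUnits (Fin N)) R₁ R₂ x).Cfg), (𝔬12 x).Dv U = DvcoKH x.toKIdx (trBasis N) (bg9YR (Matrix (Fin N) (Fin N) ℂ) (specialUnitaryUnits (Fin N)) R₁ R₂ x) (fun U => U) U)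
    (hDvsco12 : ∀ (x : MemberY d ℓ hd hL b₀ b₁ Mstar) (U : (bg9YR (Matrix (Fin N) (Fin N) ℂ) (specialUnitaryUnits (Fin N)) R₁ R₂ x).Cfg), (𝔬12 x).Dvstar U = DvscoKH x.toKIdx (trBasis N) (bg9YR (Matrix (Fin N) (Fin N) ℂ) (specialUnitaryUnits (Fin N)) R₁ R₂ x) (fun U => U) U)
    (𝔭A : ∀ x : MemberY d ℓ hd hL b₀ b₁ Mstar, HolderProbes (geo9Y x) (bg9YR (Matrix (Fin N) (Fin N) ℂ) (specialUnitaryUnits (Fin N)) R₁ R₂ x) (XBK (TrIdx N) x.toKIdx) (XBK (TrIdx N) x.toKIdx) (PK (FBondY x.toKIdx) (Fin (d + 1)) (TrIdx N)) (PK (FBondY x.toKIdx) (Fin (d + 1)) (TrIdx N)))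
    {parB : ∀ x : MemberY d ℓ hd hL b₀ b₁ Mstar, BondParY (Matrix (Fin N) (Fin N) ℂ) x.toKIdx}
    (hparB : ∀ x : MemberY d ℓ hd hL b₀ b₁ Mstar, parB x = parBY x.toKIdx)
    (h𝔭A : ∀ x : MemberY d ℓ hd hL b₀ b₁ Mstar, 𝔭A x = holderProbesKA x.toKIdx (trBasis N) (bg9YR (Matrix (Fin N) (Fin N) ℂ) (specialUnitaryUnits (Fin N)) R₁ R₂ x) (fun U => U) (parB x) (bI x))
    (Dd Dsd : ∀ x : MemberY d ℓ hd hL b₀ b₁ Mstar, (bg9YR (Matrix (Fin N) (Fin N) ℂ) (specialUnitaryUnits (Fin N)) R₁ R₂ x).Cfg → Fin (d + 1) → Module.End ℝ (XBK (TrIdx N) x.toKIdx → ℝ))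
    (hDd : ∀ (x : MemberY d ℓ hd hL b₀ b₁ Mstar) (U : (bg9YR (Matrix (Fin N) (Fin N) ℂ) (specialUnitaryUnits (Fin N)) R₁ R₂ x).Cfg), Dd x U = fun ν => coordOpK (trBasis N) (fun _ : Fin (d + 1) => cdBₗ x.toKIdx U ν))
    {Gp : ∀ x : MemberY d ℓ hd hL b₀ b₁ Mstar, SiteOpY (Matrix (Fin N) (Fin N) ℂ) x.toKIdx}
    (hGp : ∀ x : MemberY d ℓ hd hL b₀ b₁ Mstar, Gp x = GpY x.toKIdx (parT x.toKIdx))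
    {parS : ∀ x : MemberY d ℓ hd hL b₀ b₁ Mstar, SiteParY (Matrix (Fin N) (Fin N) ℂ) x.toKIdx}
    (hparS : ∀ x : MemberY d ℓ hd hL b₀ b₁ Mstar, parS x = parT x.toKIdx)
    -- letters of the input facts (implicit, read off the facts) and the two target rates
    {B₀ δ₀ CP δ49 tJ δB B43 δ43 tA δT B44 δ44 B12₃ δ12₃ Bx13₀ B12₀ δ12₀ B₀G δ₀G BHG B₃ δ₃ δK δP CW : ℝ} {Bx13 Bh12 Bi BhG Bd BhD BdX : ℝ → ℝ}
    (hB₀ : 0 ≤ B₀) (hCP : 0 ≤ CP) (htJ : 0 ≤ tJ) (hB43 : 0 ≤ B43) (htA : 0 ≤ tA) (hB44 : 0 ≤ B44) (hB12₃ : 0 ≤ B12₃) (hBx13 : ∀ β, 0 ≤ β → β < 1 → 0 ≤ Bx13 β) (hBx13₀ : 0 ≤ Bx13₀)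
    (hwBx13 : ∀ s, 0 < s → s < 1 → wX s * Bx13 s ≤ Bx13₀) (hB12₀ : 0 ≤ B12₀) (hBh12 : ∀ β, 0 ≤ β → β < 1 → 0 ≤ Bh12 β) (hBi : ∀ ε, 0 < ε → ε ≤ 1 → 0 ≤ Bi ε) (hB₀G : 0 ≤ B₀G) (hBhG : ∀ s, 0 < s → s < 1 → 0 ≤ BhG s)
    (hBHG : 0 ≤ BHG) (hwBhG : ∀ s, 0 < s → s < 1 → wX s * BhG s ≤ BHG) (hBd : ∀ ε, 0 < ε → 0 ≤ Bd ε) (hCW : 0 ≤ CW) (hB₃ : 0 ≤ B₃) (hBhD : ∀ β, 0 ≤ β → β < 1 → 0 ≤ BhD β) (hBdX : ∀ β, 0 ≤ β → β < 1 → 0 ≤ BdX β)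
    -- the rate budget: the step∕pair rate δK and the producer∕reading rate δP against the input rates (σ = the row-sum margin, τ = the (Lʲη)-weight loss)
    (hδK : 0 ≤ δK) (hr0 : δK + 3 * σ + 4 * τ ≤ δ₀) (hr49 : δK + 3 * σ + 4 * τ ≤ δ49) (hr44 : δK + 3 * σ + 5 * τ ≤ δ44) (hrB : δK + 3 * σ + 4 * τ ≤ δB)
    (hr43 : δK + 2 * σ + τ ≤ δ43) (hrT : δK + τ + σ ≤ δT) (hK3d : δK + τ + σ ≤ δ₃) (hKP : δK + τ + σ ≤ δP)
    (hP0 : δP + 2 * τ ≤ δ12₀) (hP3 : δP + σ + 2 * τ ≤ δ12₃) (hPG : δP + τ ≤ δ₀G)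
    -- the input facts (all displayed hypotheses of the certificate of record or outputs of its G₀ layer), member-uniform above (M₀, a₀)
    (h31 : ∀ x : MemberY d ℓ hd hL b₀ b₁ Mstar, M₀ ≤ (geo9Y x).M → ∀ α₀ : ℝ, 0 < α₀ → (geo9Y x).M * α₀ ≤ a₀ → ∀ U : (bg9YR (Matrix (Fin N) (Fin N) ℂ) (specialUnitaryUnits (Fin N)) R₁ R₂ x).Cfg, (bg9YR (Matrix (Fin N) (Fin N) ℂ) (specialUnitaryUnits (Fin N)) R₁ R₂ x).Reg335 c α₀ U →
      Thm31GpMaj (g := geo9Y x) (blkSK x.toKIdx (sIK x.toKIdx (bI x))) (blkBK x.toKIdx (bI x))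
        (GcoS x.toKIdx (trBasis N) (bg9YR (Matrix (Fin N) (Fin N) ℂ) (specialUnitaryUnits (Fin N)) R₁ R₂ x) (fun U => U) (Gp x) U)
        (DvcoKH x.toKIdx (trBasis N) (bg9YR (Matrix (Fin N) (Fin N) ℂ) (specialUnitaryUnits (Fin N)) R₁ R₂ x) (fun U => U) U) (DvscoKH x.toKIdx (trBasis N) (bg9YR (Matrix (Fin N) (Fin N) ℂ) (specialUnitaryUnits (Fin N)) R₁ R₂ x) (fun U => U) U) 1 (H x) B₀ δ₀)
    (h49 : ∀ x : MemberY d ℓ hd hL b₀ b₁ Mstar, M₀ ≤ (geo9Y x).M → ∀ α₀ : ℝ, 0 < α₀ → (geo9Y x).M * α₀ ≤ a₀ → ∀ U : (bg9YR (Matrix (Fin N) (Fin N) ℂ) (specialUnitaryUnits (Fin N)) R₁ R₂ x).Cfg, (bg9YR (Matrix (Fin N) (Fin N) ℂ) (specialUnitaryUnits (Fin N)) R₁ R₂ x).Reg335 c α₀ U →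
      Proj349Maj (g := geo9Y x) (blkSK x.toKIdx (sIK x.toKIdx (bI x))) (blkBK x.toKIdx (bI x))
        (PcoK x.toKIdx (trBasis N) (bg9YR (Matrix (Fin N) (Fin N) ℂ) (specialUnitaryUnits (Fin N)) R₁ R₂ x) (fun U => U) (parS x) (Gp x) U)
        (DvcoKH x.toKIdx (trBasis N) (bg9YR (Matrix (Fin N) (Fin N) ℂ) (specialUnitaryUnits (Fin N)) R₁ R₂ x) (fun U => U) U) (DvscoKH x.toKIdx (trBasis N) (bg9YR (Matrix (Fin N) (Fin N) ℂ) (specialUnitaryUnits (Fin N)) R₁ R₂ x) (fun U => U) U) 1 (H x) CP δ49)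
    (h43 : ∀ x : MemberY d ℓ hd hL b₀ b₁ Mstar, letI : Fintype (geo9K x.toKIdx).Site := (inferInstance : Fintype (geo9Y x).Site); M₀ ≤ (geo9Y x).M → ∀ α₀ : ℝ, 0 < α₀ → (geo9Y x).M * α₀ ≤ a₀ → ∀ U : (bg9YR (Matrix (Fin N) (Fin N) ℂ) (specialUnitaryUnits (Fin N)) R₁ R₂ x).Cfg, (bg9YR (Matrix (Fin N) (Fin N) ℂ) (specialUnitaryUnits (Fin N)) R₁ R₂ x).Reg335 c α₀ U →
      (bg9YR (Matrix (Fin N) (Fin N) ℂ) (specialUnitaryUnits (Fin N)) R₁ R₂ x).Reg336 c α₀ U →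
        HasMaj (cNorm 1 (H x) (𝔬12 x).blk (fun y => (geo9Y_len_pos x y).le) 0) (bH13 x U)
          (GcoS x.toKIdx (trBasis N) (bg9YR (Matrix (Fin N) (Fin N) ℂ) (specialUnitaryUnits (Fin N)) R₁ R₂ x) (fun U => U) (GpY x.toKIdx (parT x.toKIdx)) U ∘ₗ DvscoKH x.toKIdx (trBasis N) (bg9YR (Matrix (Fin N) (Fin N) ℂ) (specialUnitaryUnits (Fin N)) R₁ R₂ x) (fun U => U) U)
          (fun a a' => B43 * Real.exp (-(δ43 * (geo9Y x).dist a a'))))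
    (h44G : ∀ x : MemberY d ℓ hd hL b₀ b₁ Mstar, letI : Fintype (geo9K x.toKIdx).Site := (inferInstance : Fintype (geo9Y x).Site); M₀ ≤ (geo9Y x).M → ∀ α₀ : ℝ, 0 < α₀ → (geo9Y x).M * α₀ ≤ a₀ → ∀ U : (bg9YR (Matrix (Fin N) (Fin N) ℂ) (specialUnitaryUnits (Fin N)) R₁ R₂ x).Cfg, (bg9YR (Matrix (Fin N) (Fin N) ℂ) (specialUnitaryUnits (Fin N)) R₁ R₂ x).Reg335 c α₀ U → (bg9YR (Matrix (Fin N) (Fin N) ℂ) (specialUnitaryUnits (Fin N)) R₁ R₂ x).Reg336 c α₀ U →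
      HasMaj (bHZKP (κ := TrIdx N) x.toKIdx (trBasis N) (taxiB x.toKIdx (bg9YR (Matrix (Fin N) (Fin N) ℂ) (specialUnitaryUnits (Fin N)) R₁ R₂ x) (fun U => U) U) (R := (1 : ℝ)) (H := H x) hs440.le hs441.le) (cNorm 1 (H x) (𝔬12 x).blk (fun y => (geo9Y_len_pos x y).le) 1)
        ((𝔬12 x).Dv U ∘ₗ GcoS x.toKIdx (trBasis N) (bg9YR (Matrix (Fin N) (Fin N) ℂ) (specialUnitaryUnits (Fin N)) R₁ R₂ x) (fun U => U) (GpY x.toKIdx (parT x.toKIdx)) U ∘ₗ (𝔬12 x).Dvstar U) (fun a b => B44 * Real.exp (-(δ44 * (geo9Y x).dist a b))))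
    (hta : ∀ x : MemberY d ℓ hd hL b₀ b₁ Mstar, M₀ ≤ (geo9Y x).M → ∀ α₀ : ℝ, 0 < α₀ → (geo9Y x).M * α₀ ≤ a₀ → ∀ U : (bg9YR (Matrix (Fin N) (Fin N) ℂ) (specialUnitaryUnits (Fin N)) R₁ R₂ x).Cfg, (bg9YR (Matrix (Fin N) (Fin N) ℂ) (specialUnitaryUnits (Fin N)) R₁ R₂ x).Reg335 c α₀ U →
      (bg9YR (Matrix (Fin N) (Fin N) ℂ) (specialUnitaryUnits (Fin N)) R₁ R₂ x).Reg336 c α₀ U → HasMaj (cNorm 1 (H x) (𝔬12 x).blk (fun y => (geo9Y_len_pos x y).le) 2) (cNorm 1 (H x) (𝔬12 x).blk (fun y => (geo9Y_len_pos x y).le) 0) (TaLcoK x.toKIdx (trBasis N) (bg9YR (Matrix (Fin N) (Fin N) ℂ) (specialUnitaryUnits (Fin N)) R₁ R₂ x) (fun U => U) (parT x.toKIdx) (GpPhysY x.toKIdx (parT x.toKIdx)) U) (fun a a' => tA * ((geo9Y x).M * α₀) * Real.exp (-(δT * (geo9Y x).dist a a'))))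
    (hBJ : ∀ x : MemberY d ℓ hd hL b₀ b₁ Mstar, M₀ ≤ (geo9Y x).M → ∀ α₀ : ℝ, 0 < α₀ → (geo9Y x).M * α₀ ≤ a₀ → ∀ U : (bg9YR (Matrix (Fin N) (Fin N) ℂ) (specialUnitaryUnits (Fin N)) R₁ R₂ x).Cfg, (bg9YR (Matrix (Fin N) (Fin N) ℂ) (specialUnitaryUnits (Fin N)) R₁ R₂ x).Reg335 c α₀ U →
      (bg9YR (Matrix (Fin N) (Fin N) ℂ) (specialUnitaryUnits (Fin N)) R₁ R₂ x).Reg336 c α₀ U → CurrentMaj (𝔬12 x).blkW (𝔬12 x).blk (BcoKH x.toKIdx (trBasis N) (bg9YR (Matrix (Fin N) (Fin N) ℂ) (specialUnitaryUnits (Fin N)) R₁ R₂ x) (fun U => U) U)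
        (BdcoKH x.toKIdx (trBasis N) (bg9YR (Matrix (Fin N) (Fin N) ℂ) (specialUnitaryUnits (Fin N)) R₁ R₂ x) (fun U => U) U) 1 (H x) (tJ * ((geo9Y x).M * α₀)) δB)
    (hZ81 : ∀ x : MemberY d ℓ hd hL b₀ b₁ Mstar, M₀ ≤ (geo9Y x).M → ∀ α₀ : ℝ, 0 < α₀ → (geo9Y x).M * α₀ ≤ a₀ → ∀ U : (bg9YR (Matrix (Fin N) (Fin N) ℂ) (specialUnitaryUnits (Fin N)) R₁ R₂ x).Cfg, (bg9YR (Matrix (Fin N) (Fin N) ℂ) (specialUnitaryUnits (Fin N)) R₁ R₂ x).Reg335 c α₀ U → (bg9YR (Matrix (Fin N) (Fin N) ℂ) (specialUnitaryUnits (Fin N)) R₁ R₂ x).Reg336 c α₀ U →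
      HasMaj (cNorm 1 (H x) (𝔬12 x).blkW (fun y => (geo9Y_len_pos x y).le) 1) (cNorm 1 (H x) (𝔬12 x).blk (fun y => (geo9Y_len_pos x y).le) 2) ((𝔬12 x).G0 U ∘ₗ (𝔬12 x).Dv U)
        (fun a b => B12₃ * Real.exp (-(δ12₃ * (geo9Y x).dist a b))))
    (hpXDv : ∀ x : MemberY d ℓ hd hL b₀ b₁ Mstar, M₀ ≤ (geo9Y x).M → ∀ α₀ : ℝ, 0 < α₀ → (geo9Y x).M * α₀ ≤ a₀ → ∀ U : (bg9YR (Matrix (Fin N) (Fin N) ℂ) (specialUnitaryUnits (Fin N)) R₁ R₂ x).Cfg, (bg9YR (Matrix (Fin N) (Fin N) ℂ) (specialUnitaryUnits (Fin N)) R₁ R₂ x).Reg335 c α₀ U → (bg9YR (Matrix (Fin N) (Fin N) ℂ) (specialUnitaryUnits (Fin N)) R₁ R₂ x).Reg336 c α₀ U → ∀ β : ℝ, 0 ≤ β → β < 1 →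
      HasMaj (cNormR 1 (H x) (𝔬12 x).blkW (fun y => (geo9Y_len_pos x y).le) 0) (cNormR 1 (H x) (𝔭A x).blkPX (fun y => (geo9Y_len_pos x y).le) (β - 1))
        (((𝔭A x).ΦX U β ∘ₗ (𝔬12 x).G0 U) ∘ₗ (𝔬12 x).Dv U) (fun a b => Bx13 β * Real.exp (-(δ12₃ * (geo9Y x).dist a b))))
    (he0 : ∀ x : MemberY d ℓ hd hL b₀ b₁ Mstar, M₀ ≤ (geo9Y x).M → ∀ α₀ : ℝ, 0 < α₀ → (geo9Y x).M * α₀ ≤ a₀ → ∀ U : (bg9YR (Matrix (Fin N) (Fin N) ℂ) (specialUnitaryUnits (Fin N)) R₁ R₂ x).Cfg, (bg9YR (Matrix (Fin N) (Fin N) ℂ) (specialUnitaryUnits (Fin N)) R₁ R₂ x).Reg335 c α₀ U → (bg9YR (Matrix (Fin N) (Fin N) ℂ) (specialUnitaryUnits (Fin N)) R₁ R₂ x).Reg336 c α₀ U →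
      HasMajorant (g := toB6 (geo9Y x) 1 (H x)) (𝔬12 x).blk ((𝔬12 x).G0 U) (fun (a b : (geo9Y x).Site) => B12₀ * (geo9Y x).len a ^ 2 * Real.exp (-(δ12₀ * (geo9Y x).dist a b))))
    (he1d : ∀ x : MemberY d ℓ hd hL b₀ b₁ Mstar, M₀ ≤ (geo9Y x).M → ∀ α₀ : ℝ, 0 < α₀ → (geo9Y x).M * α₀ ≤ a₀ → ∀ U : (bg9YR (Matrix (Fin N) (Fin N) ℂ) (specialUnitaryUnits (Fin N)) R₁ R₂ x).Cfg, (bg9YR (Matrix (Fin N) (Fin N) ℂ) (specialUnitaryUnits (Fin N)) R₁ R₂ x).Reg335 c α₀ U → (bg9YR (Matrix (Fin N) (Fin N) ℂ) (specialUnitaryUnits (Fin N)) R₁ R₂ x).Reg336 c α₀ U → ∀ μ : Fin (d + 1),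
      HasMajorantHom (g := toB6 (geo9Y x) 1 (H x)) (𝔬12 x).blk (𝔬12 x).blk (Dd x U μ ∘ₗ (𝔬12 x).G0 U)
        (fun (a b : (geo9Y x).Site) => B12₀ * (geo9Y x).len a * Real.exp (-(δ12₀ * (geo9Y x).dist a b))))
    (he2 : ∀ x : MemberY d ℓ hd hL b₀ b₁ Mstar, M₀ ≤ (geo9Y x).M → ∀ α₀ : ℝ, 0 < α₀ → (geo9Y x).M * α₀ ≤ a₀ → ∀ U : (bg9YR (Matrix (Fin N) (Fin N) ℂ) (specialUnitaryUnits (Fin N)) R₁ R₂ x).Cfg, (bg9YR (Matrix (Fin N) (Fin N) ℂ) (specialUnitaryUnits (Fin N)) R₁ R₂ x).Reg335 c α₀ U → (bg9YR (Matrix (Fin N) (Fin N) ℂ) (specialUnitaryUnits (Fin N)) R₁ R₂ x).Reg336 c α₀ U →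
      HasMajorantHom (g := toB6 (geo9Y x) 1 (H x)) (𝔬12 x).blkY (𝔬12 x).blk ((𝔬12 x).G0 U ∘ₗ (𝔬12 x).Dstar U) (fun a b => B₀G * (geo9Y x).len a * Real.exp (-(δ₀G * (geo9Y x).dist a b))))
    (h43RG : ∀ x : MemberY d ℓ hd hL b₀ b₁ Mstar, M₀ ≤ (geo9Y x).M → ∀ α₀ : ℝ, 0 < α₀ → (geo9Y x).M * α₀ ≤ a₀ → ∀ U : (bg9YR (Matrix (Fin N) (Fin N) ℂ) (specialUnitaryUnits (Fin N)) R₁ R₂ x).Cfg, (bg9YR (Matrix (Fin N) (Fin N) ℂ) (specialUnitaryUnits (Fin N)) R₁ R₂ x).Reg335 c α₀ U → (bg9YR (Matrix (Fin N) (Fin N) ℂ) (specialUnitaryUnits (Fin N)) R₁ R₂ x).Reg336 c α₀ U →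
      ∀ s' : ℝ, 0 < s' → s' < 1 → HasMajorantHom (g := toB6 (geo9Y x) 1 (H x)) (𝔬12 x).blkY (𝔭A x).blkPX ((𝔭A x).ΦX U s' ∘ₗ ((𝔬12 x).G0 U ∘ₗ (𝔬12 x).Dstar U)) (fun (a b : (geo9Y x).Site) => BhG s' * (geo9Y x).len a ^ (1 - s') * Real.exp (-(δ₀G * (geo9Y x).dist a b))))
    (hgQs1 : ∀ x : MemberY d ℓ hd hL b₀ b₁ Mstar, M₀ ≤ (geo9Y x).M → ∀ α₀ : ℝ, 0 < α₀ → (geo9Y x).M * α₀ ≤ a₀ → ∀ U : (bg9YR (Matrix (Fin N) (Fin N) ℂ) (specialUnitaryUnits (Fin N)) R₁ R₂ x).Cfg, (bg9YR (Matrix (Fin N) (Fin N) ℂ) (specialUnitaryUnits (Fin N)) R₁ R₂ x).Reg335 c α₀ U → (bg9YR (Matrix (Fin N) (Fin N) ℂ) (specialUnitaryUnits (Fin N)) R₁ R₂ x).Reg336 c α₀ U →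
      HasMaj (weightNorm (BlockNorm.ofBlocks (toB6 (geo9Y x) 1 (H x)) (𝔬12 x).blkZ) (fun y => (geo9Y x).len y * (fun y => ((((ℓ + 1 : ℕ) : ℝ) ^ (d + 1)) ^ lvl x.hN x.D x.hk y)⁻¹) y) (fun y => (mul_pos (geo9Y_len_pos x y) (plateau_pos x.toKIdx y)).le)) (cNorm 1 (H x) (𝔬12 x).blk (fun y => (geo9Y_len_pos x y).le) 1) ((𝔬12 x).G0 U ∘ₗ (𝔬12 x).Qstar U) (fun a b => B12₃ * Real.exp (-(δ12₃ * (geo9Y x).dist a b))))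
    (hpXQs : ∀ x : MemberY d ℓ hd hL b₀ b₁ Mstar, M₀ ≤ (geo9Y x).M → ∀ α₀ : ℝ, 0 < α₀ → (geo9Y x).M * α₀ ≤ a₀ → ∀ U : (bg9YR (Matrix (Fin N) (Fin N) ℂ) (specialUnitaryUnits (Fin N)) R₁ R₂ x).Cfg, (bg9YR (Matrix (Fin N) (Fin N) ℂ) (specialUnitaryUnits (Fin N)) R₁ R₂ x).Reg335 c α₀ U → (bg9YR (Matrix (Fin N) (Fin N) ℂ) (specialUnitaryUnits (Fin N)) R₁ R₂ x).Reg336 c α₀ U → ∀ β : ℝ, 0 ≤ β → β < 1 →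
      HasMaj (weightNorm (BlockNorm.ofBlocks (toB6 (geo9Y x) 1 (H x)) (𝔬12 x).blkZ) (fun y => (geo9Y x).len y * (fun y => ((((ℓ + 1 : ℕ) : ℝ) ^ (d + 1)) ^ lvl x.hN x.D x.hk y)⁻¹) y) (fun y => (mul_pos (geo9Y_len_pos x y) (plateau_pos x.toKIdx y)).le)) (cNormR 1 (H x) (𝔭A x).blkPX (fun y => (geo9Y_len_pos x y).le) (β - 1)) (((𝔭A x).ΦX U β ∘ₗ (𝔬12 x).G0 U) ∘ₗ (𝔬12 x).Qstar U) (fun a b => Bx13 β * Real.exp (-(δ12₃ * (geo9Y x).dist a b))))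
    (hDirR : ∀ x : MemberY d ℓ hd hL b₀ b₁ Mstar, M₀ ≤ (geo9Y x).M → ∀ α₀ : ℝ, 0 < α₀ → (geo9Y x).M * α₀ ≤ a₀ → ∀ U : (bg9YR (Matrix (Fin N) (Fin N) ℂ) (specialUnitaryUnits (Fin N)) R₁ R₂ x).Cfg, (bg9YR (Matrix (Fin N) (Fin N) ℂ) (specialUnitaryUnits (Fin N)) R₁ R₂ x).Reg335 c α₀ U → (bg9YR (Matrix (Fin N) (Fin N) ℂ) (specialUnitaryUnits (Fin N)) R₁ R₂ x).Reg336 c α₀ U →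
      Thm33G0DirR (𝔬12 x) (Dsd x) 1 (H x) B12₀ δ12₀ U)
    (hDir : ∀ x : MemberY d ℓ hd hL b₀ b₁ Mstar, M₀ ≤ (geo9Y x).M → ∀ α₀ : ℝ, 0 < α₀ → (geo9Y x).M * α₀ ≤ a₀ → ∀ U : (bg9YR (Matrix (Fin N) (Fin N) ℂ) (specialUnitaryUnits (Fin N)) R₁ R₂ x).Cfg, (bg9YR (Matrix (Fin N) (Fin N) ℂ) (specialUnitaryUnits (Fin N)) R₁ R₂ x).Reg335 c α₀ U → (bg9YR (Matrix (Fin N) (Fin N) ℂ) (specialUnitaryUnits (Fin N)) R₁ R₂ x).Reg336 c α₀ U →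
      ∀ (q : Fin (d + 1) × Fin (d + 1)) (ε : ℝ), 0 < ε → ε ≤ 1 → HasMaj (bHXA x ε) (BlockNorm.ofBlocks (toB6 (geo9Y x) 1 (H x)) (𝔬12 x).blk) (Dd x U q.1 ∘ₗ ((𝔬12 x).G0 U ∘ₗ Dsd x U q.2))
        (fun (a b : (geo9Y x).Site) => Bi ε * Real.exp (-(δ12₀ * (geo9Y x).dist a b))))
    (hdgDvd : ∀ x : MemberY d ℓ hd hL b₀ b₁ Mstar, M₀ ≤ (geo9Y x).M → ∀ α₀ : ℝ, 0 < α₀ → (geo9Y x).M * α₀ ≤ a₀ → ∀ U : (bg9YR (Matrix (Fin N) (Fin N) ℂ) (specialUnitaryUnits (Fin N)) R₁ R₂ x).Cfg, (bg9YR (Matrix (Fin N) (Fin N) ℂ) (specialUnitaryUnits (Fin N)) R₁ R₂ x).Reg335 c α₀ U → (bg9YR (Matrix (Fin N) (Fin N) ℂ) (specialUnitaryUnits (Fin N)) R₁ R₂ x).Reg336 c α₀ U →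
      ∀ (ν : Fin (d + 1)) (ε : ℝ), 0 < ε →
        HasMaj (bW x U ε) (BlockNorm.ofBlocks (toB6 (geo9Y x) 1 (H x)) (𝔬12 x).blk) (Dd x U ν ∘ₗ ((𝔬12 x).G0 U ∘ₗ (𝔬12 x).Dv U)) (fun (a b : (geo9Y x).Site) => Bd ε * Real.exp (-(δ12₃ * (geo9Y x).dist a b))))
    -- (variant `W`) the site class DOMINATES the block-sup class of the site fields: the source transfer of the z-letters' sup word into `bW x U ε` (class lemma, displayed)
    (htransW : ∀ x : MemberY d ℓ hd hL b₀ b₁ Mstar, M₀ ≤ (geo9Y x).M → ∀ (U : (bg9YR (Matrix (Fin N) (Fin N) ℂ) (specialUnitaryUnits (Fin N)) R₁ R₂ x).Cfg) (ε : ℝ), 0 < ε → ∀ K : ℝ, 0 ≤ K → HasMaj (BlockNorm.ofBlocks (toB6 (geo9Y x) 1 (H x)) (blkSK x.toKIdx (sIK x.toKIdx (bI x)))) (cNormR 1 (H x) (blkBK x.toKIdx (bI x)) (fun y => (geo9Y_len_pos x y).le) (-1)) ((𝔬12 x).G0 U ∘ₗ (𝔬12 x).Dv U) (fun a b => K * Real.exp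 (-((δ12₃ - τ) * (geo9Y x).dist a b))) →
      HasMaj (bW x U ε) (cNormR 1 (H x) (blkBK x.toKIdx (bI x)) (fun y => (geo9Y_len_pos x y).le) (-1)) ((𝔬12 x).G0 U ∘ₗ (𝔬12 x).Dv U) (fun a b => CW * K * Real.exp (-((δ12₃ - τ) * (geo9Y x).dist a b))))
    (he1 : ∀ x : MemberY d ℓ hd hL b₀ b₁ Mstar, M₀ ≤ (geo9Y x).M → ∀ α₀ : ℝ, 0 < α₀ → (geo9Y x).M * α₀ ≤ a₀ → ∀ U : (bg9YR (Matrix (Fin N) (Fin N) ℂ) (specialUnitaryUnits (Fin N)) R₁ R₂ x).Cfg, (bg9YR (Matrix (Fin N) (Fin N) ℂ) (specialUnitaryUnits (Fin N)) R₁ R₂ x).Reg335 c α₀ U → (bg9YR (Matrix (Fin N) (Fin N) ℂ) (specialUnitaryUnits (Fin N)) R₁ R₂ x).Reg336 c α₀ U →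
      HasMajorantHom (g := toB6 (geo9Y x) 1 (H x)) (𝔬12 x).blk (𝔬12 x).blkY ((𝔬12 x).D U ∘ₗ (𝔬12 x).G0 U) (fun (a b : (geo9Y x).Site) => B12₀ * (geo9Y x).len a * Real.exp (-(δ12₀ * (geo9Y x).dist a b))))
    (h43L : ∀ x : MemberY d ℓ hd hL b₀ b₁ Mstar, M₀ ≤ (geo9Y x).M → ∀ α₀ : ℝ, 0 < α₀ → (geo9Y x).M * α₀ ≤ a₀ → ∀ U : (bg9YR (Matrix (Fin N) (Fin N) ℂ) (specialUnitaryUnits (Fin N)) R₁ R₂ x).Cfg, (bg9YR (Matrix (Fin N) (Fin N) ℂ) (specialUnitaryUnits (Fin N)) R₁ R₂ x).Reg335 c α₀ U → (bg9YR (Matrix (Fin N) (Fin N) ℂ) (specialUnitaryUnits (Fin N)) R₁ R₂ x).Reg336 c α₀ U → ∀ β : ℝ, 0 ≤ β → β < 1 →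
      HasMajorantHom (g := toB6 (geo9Y x) 1 (H x)) (𝔬12 x).blk (𝔭A x).blkPY ((𝔭A x).ΦY U β ∘ₗ ((𝔬12 x).D U ∘ₗ (𝔬12 x).G0 U)) (fun (a b : (geo9Y x).Site) => Bh12 β * (geo9Y x).len a ^ (1 - β) * Real.exp (-(δ12₀ * (geo9Y x).dist a b))))
    (h43d : ∀ x : MemberY d ℓ hd hL b₀ b₁ Mstar, M₀ ≤ (geo9Y x).M → ∀ α₀ : ℝ, 0 < α₀ → (geo9Y x).M * α₀ ≤ a₀ → ∀ U : (bg9YR (Matrix (Fin N) (Fin N) ℂ) (specialUnitaryUnits (Fin N)) R₁ R₂ x).Cfg, (bg9YR (Matrix (Fin N) (Fin N) ℂ) (specialUnitaryUnits (Fin N)) R₁ R₂ x).Reg335 c α₀ U → (bg9YR (Matrix (Fin N) (Fin N) ℂ) (specialUnitaryUnits (Fin N)) R₁ R₂ x).Reg336 c α₀ U → ∀ (ν : Fin (d + 1)) (β : ℝ), 0 ≤ β → β < 1 →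
      HasMajorantHom (g := toB6 (geo9Y x) 1 (H x)) (𝔬12 x).blk (𝔭A x).blkPX ((𝔭A x).ΦX U β ∘ₗ (Dd x U ν ∘ₗ (𝔬12 x).G0 U)) (fun (a b : (geo9Y x).Site) => Bh12 β * (geo9Y x).len a ^ (1 - β) * Real.exp (-(δ12₀ * (geo9Y x).dist a b))))
    (hdgDH : ∀ x : MemberY d ℓ hd hL b₀ b₁ Mstar, M₀ ≤ (geo9Y x).M → ∀ α₀ : ℝ, 0 < α₀ → (geo9Y x).M * α₀ ≤ a₀ → ∀ U : (bg9YR (Matrix (Fin N) (Fin N) ℂ) (specialUnitaryUnits (Fin N)) R₁ R₂ x).Cfg, (bg9YR (Matrix (Fin N) (Fin N) ℂ) (specialUnitaryUnits (Fin N)) R₁ R₂ x).Reg335 c α₀ U → (bg9YR (Matrix (Fin N) (Fin N) ℂ) (specialUnitaryUnits (Fin N)) R₁ R₂ x).Reg336 c α₀ U →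
      HasMaj (bH13 x U) (cNorm 1 (H x) (𝔬12 x).blkY (fun y => (geo9Y_len_pos x y).le) 1) ((𝔬12 x).D U ∘ₗ (𝔬12 x).G0 U ∘ₗ (𝔬12 x).Dv U) (fun a a' => B₃ * Real.exp (-(δ₃ * (geo9Y x).dist a a'))))
    (hdgDHd : ∀ x : MemberY d ℓ hd hL b₀ b₁ Mstar, M₀ ≤ (geo9Y x).M → ∀ α₀ : ℝ, 0 < α₀ → (geo9Y x).M * α₀ ≤ a₀ → ∀ U : (bg9YR (Matrix (Fin N) (Fin N) ℂ) (specialUnitaryUnits (Fin N)) R₁ R₂ x).Cfg, (bg9YR (Matrix (Fin N) (Fin N) ℂ) (specialUnitaryUnits (Fin N)) R₁ R₂ x).Reg335 c α₀ U → (bg9YR (Matrix (Fin N) (Fin N) ℂ) (specialUnitaryUnits (Fin N)) R₁ R₂ x).Reg336 c α₀ U → ∀ ν : Fin (d + 1),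
      HasMaj (bH13 x U) (cNorm 1 (H x) (𝔬12 x).blk (fun y => (geo9Y_len_pos x y).le) 1) (Dd x U ν ∘ₗ (𝔬12 x).G0 U ∘ₗ (𝔬12 x).Dv U) (fun a a' => B₃ * Real.exp (-(δ₃ * (geo9Y x).dist a a'))))
    (hYd : ∀ x : MemberY d ℓ hd hL b₀ b₁ Mstar, M₀ ≤ (geo9Y x).M → ∀ α₀ : ℝ, 0 < α₀ → (geo9Y x).M * α₀ ≤ a₀ → ∀ U : (bg9YR (Matrix (Fin N) (Fin N) ℂ) (specialUnitaryUnits (Fin N)) R₁ R₂ x).Cfg, (bg9YR (Matrix (Fin N) (Fin N) ℂ) (specialUnitaryUnits (Fin N)) R₁ R₂ x).Reg335 c α₀ U → (bg9YR (Matrix (Fin N) (Fin N) ℂ) (specialUnitaryUnits (Fin N)) R₁ R₂ x).Reg336 c α₀ U → ∀ β : ℝ, 0 ≤ β → β < 1 →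
      HasMaj (bH13 x U) (cNormR 1 (H x) (𝔭A x).blkPY (fun y => (geo9Y_len_pos x y).le) (β - 1)) (((𝔭A x).ΦY U β ∘ₗ (𝔬12 x).D U ∘ₗ (𝔬12 x).G0 U) ∘ₗ (𝔬12 x).Dv U) (fun a a' => BhD β * Real.exp (-(δ₃ * (geo9Y x).dist a a'))))
    (hXd : ∀ x : MemberY d ℓ hd hL b₀ b₁ Mstar, M₀ ≤ (geo9Y x).M → ∀ α₀ : ℝ, 0 < α₀ → (geo9Y x).M * α₀ ≤ a₀ → ∀ U : (bg9YR (Matrix (Fin N) (Fin N) ℂ) (specialUnitaryUnits (Fin N)) R₁ R₂ x).Cfg, (bg9YR (Matrix (Fin N) (Fin N) ℂ) (specialUnitaryUnits (Fin N)) R₁ R₂ x).Reg335 c α₀ U → (bg9YR (Matrix (Fin N) (Fin N) ℂ) (specialUnitaryUnits (Fin N)) R₁ R₂ x).Reg336 c α₀ U → ∀ (ν : Fin (d + 1)) (β : ℝ), 0 ≤ β → β < 1 →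
      HasMaj (bH13 x U) (cNormR 1 (H x) (𝔭A x).blkPX (fun y => (geo9Y_len_pos x y).le) (β - 1)) (((𝔭A x).ΦX U β ∘ₗ Dd x U ν ∘ₗ (𝔬12 x).G0 U) ∘ₗ (𝔬12 x).Dv U) (fun a a' => BdX β * Real.exp (-(δ₃ * (geo9Y x).dist a a'))))
    -- NEW w.r.t. the state layer: positivity of the regime letter, the resolvent identities of the model (the certificate's `hmodel12 … .2.2`), the target rate ρ_G with its budget
    (ha₀ : 0 < a₀)
    (hinvG0 : ∀ x : MemberY d ℓ hd hL b₀ b₁ Mstar, M₀ ≤ (geo9Y x).M → ∀ α₀ : ℝ, 0 < α₀ → (geo9Y x).M * α₀ ≤ a₀ → ∀ U : (bg9YR (Matrix (Fin N) (Fin N) ℂ) (specialUnitaryUnits (Fin N)) R₁ R₂ x).Cfg, (bg9YR (Matrix (Fin N) (Fin N) ℂ) (specialUnitaryUnits (Fin N)) R₁ R₂ x).Reg335 c α₀ U →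
      (bg9YR (Matrix (Fin N) (Fin N) ℂ) (specialUnitaryUnits (Fin N)) R₁ R₂ x).Reg336 c α₀ U → (𝔬12 x).G0 U * (𝔬12 x).S0 U = 1)
    (hinvG : ∀ x : MemberY d ℓ hd hL b₀ b₁ Mstar, M₀ ≤ (geo9Y x).M → ∀ α₀ : ℝ, 0 < α₀ → (geo9Y x).M * α₀ ≤ a₀ → ∀ U : (bg9YR (Matrix (Fin N) (Fin N) ℂ) (specialUnitaryUnits (Fin N)) R₁ R₂ x).Cfg, (bg9YR (Matrix (Fin N) (Fin N) ℂ) (specialUnitaryUnits (Fin N)) R₁ R₂ x).Reg335 c α₀ U →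
      (bg9YR (Matrix (Fin N) (Fin N) ℂ) (specialUnitaryUnits (Fin N)) R₁ R₂ x).Reg336 c α₀ U → ((𝔬12 x).S0 U - (𝔬12 x).Tpi U) * (𝔬12 x).G U = 1)
    {ρG : ℝ} (hρG : 0 ≤ ρG) (hρGP : ρG + σ ≤ δP) (hρGK : ρG + 2 * σ ≤ δK) :
    ∃ MG aG rG rG' : ℝ, 0 < aG ∧ aG ≤ a₀ ∧ 0 ≤ rG ∧ 0 ≤ rG' ∧
      ∀ x : MemberY d ℓ hd hL b₀ b₁ Mstar, MG ≤ (geo9Y x).M → ∀ α₀ : ℝ, 0 < α₀ → (geo9Y x).M * α₀ ≤ aG → ∀ U : (bg9YR (Matrix (Fin N) (Fin N) ℂ) (specialUnitaryUnits (Fin N)) R₁ R₂ x).Cfg, (bg9YR (Matrix (Fin N) (Fin N) ℂ) (specialUnitaryUnits (Fin N)) R₁ R₂ x).Reg335 c α₀ U →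
      (bg9YR (Matrix (Fin N) (Fin N) ℂ) (specialUnitaryUnits (Fin N)) R₁ R₂ x).Reg336 c α₀ U →
        HasMajorant (g := toB6 (geo9Y x) 1 (H x)) (𝔬12 x).blk ((𝔬12 x).G U) (fun a b => rG * (geo9Y x).len a ^ 2 * Real.exp (-(ρG * (geo9Y x).dist a b))) ∧
        HasMajorant (g := toB6 (geo9Y x) 1 (H x)) (𝔬12 x).blk ((𝔬12 x).G U - (𝔬12 x).G0 U)
          (fun a b => rG' * ((geo9Y x).M * α₀) * (geo9Y x).len a ^ 2 * Real.exp (-(ρG * (geo9Y x).dist a b))) := by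
  have hG : ∀ x : MemberY d ℓ hd hL b₀ b₁ Mstar, GeoOK (geo9Y x) := fun x => ⟨geo9Y_dist_triangle x, geo9Y_dist_comm x, geo9K_dist_nonneg x.toKIdx, geo9Y_len_pos x⟩
  obtain ⟨ML, hrow⟩ := rowConst261_spec_of_rowSum261 (rowSum261_geo9Y (d := d) (ℓ := ℓ) (hd := hd) (hL := hL) (b₀ := b₀) (b₁ := b₁) (Mstar := Mstar)) hσ
  have hc261 : 0 ≤ rowConst261 (@geo9Y d ℓ hd hL b₀ b₁ Mstar) σ := rowConst261_nonneg _ _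
  have hCL : 0 ≤ CLip d ℓ := CLip_nonneg d ℓ
  -- PASS 1: the U8 state layer at the FLAT residual `Δ⁽²⁾ := 0` (the step ∕ producers ∕ reading of the 𝔖₂-tuple never see Δ⁽²⁾; their letters are those of the real `G₀`, `Δ′_π`)
  obtain ⟨MT, θS, θD, A₀S, AW, AQ, AD, AQ1, CR, θH, AI, AV, hθS, -, -, hA₀S, -, -, -, -, hCR, -, -, hST⟩ :=
N06StateLayerAtPinsPUWPar.hStateTuplesW_of_pinsP_geo9Y_par (parT := parT) (N := N) (H := H) (bI := bI) (hlev := hlev) (hβ1 := hβ1) (hbI0 := hbI0) (hGR := hGR) (c := c) (hM₀ := hM₀) (hσ := hσ) (hτ := hτ) (w13 := w13) (hw13₀ := hw13₀)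
      (hw13₁ := hw13₁) (wX := wX) (hwX₀ := hwX₀) (hwX₁ := hwX₁) (hs440 := hs440) (hs441 := hs441) (hw1344 := hw1344) (hwX44 := hwX44) (bH13 := bH13) (hbH13 := hbH13) (hκ13 := hκ13)
      (bXH := bXH) (hbXH := hbXH) (bHXA := bHXA) (hbHXA := hbHXA) (bW := bW)
      (𝔬12 := (fun x => { 𝔬12 x with T2 := fun U => T2coK x.toKIdx (trBasis N) (bg9YR (Matrix (Fin N) (Fin N) ℂ) (specialUnitaryUnits (Fin N)) R₁ R₂ x) (fun U => U) (parT x.toKIdx) (GpPhysY x.toKIdx (parT x.toKIdx)) ((fun y : MemberY d ℓ hd hL b₀ b₁ Mstar => (0 : BondOpY (Matrix (Fin N) (Fin N) ℂ) y.toKIdx)) x) U }))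
      (hblk12 := hblk12) (hblkW12 := hblkW12) (Δ2 := (fun y : MemberY d ℓ hd hL b₀ b₁ Mstar => (0 : BondOpY (Matrix (Fin N) (Fin N) ℂ) y.toKIdx))) (hTpico12 := hTpico12)
      (hT2co12 := (fun _ _ => rfl)) (hDvco12 := hDvco12) (hDvsco12 := hDvsco12) (𝔭A := 𝔭A) (hparB := hparB) (h𝔭A := h𝔭A) (Dd := Dd) (Dsd := Dsd) (hDd := hDd) (hGp := hGp) (hparS := hparS)
      (hB₀ := hB₀) (hCP := hCP) (htJ := htJ) (hB43 := hB43) (htA := htA) (hθ₂ := (le_refl (0 : ℝ))) (hB44 := hB44) (hB12₃ := hB12₃) (hBx13 := hBx13) (hBx13₀ := hBx13₀) (hwBx13 := hwBx13)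
      (hB12₀ := hB12₀) (hBh12 := hBh12) (hBi := hBi) (hB₀G := hB₀G) (hBhG := hBhG) (hBHG := hBHG) (hwBhG := hwBhG) (hBd := hBd) (hCW := hCW) (hB₃ := hB₃) (hBhD := hBhD) (hBdX := hBdX)
      (hδK := hδK) (hr0 := hr0) (hr49 := hr49) (hr2 := (le_refl (δK + 3 * σ + 4 * τ))) (hr44 := hr44) (hrB := hrB) (hr43 := hr43) (hrT := hrT) (hK3d := hK3d) (hKP := hKP) (hP0 := hP0)
      (hP3 := hP3) (hPG := hPG) (h31 := h31) (h49 := h49) (h43 := h43) (h44G := h44G)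
      (hD2 := (fun x hM α₀ hα ha U hU hU' => hasMajorant_D2coK_zero (N := N) H x _ U _ (fun a b => by simp only [zero_mul, le_refl]))) (hta := hta) (hBJ := hBJ) (hZ81 := hZ81)
      (hpXDv := hpXDv) (he0 := he0) (he1d := he1d) (he2 := he2) (h43RG := h43RG) (hgQs1 := hgQs1) (hpXQs := hpXQs)
      (hDirR := (fun x hM α₀ hα ha U hU hU' => ⟨(hDirR x hM α₀ hα ha U hU hU').e2d⟩)) (hDir := hDir) (hdgDvd := hdgDvd) (htransW := htransW) (he1 := he1) (h43L := h43L) (h43d := h43d)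
      (hdgDH := hdgDH) (hdgDHd := hdgDHd) (hYd := hYd) (hXd := hXd)
  have hK0 : 0 ≤ (1 + CLip d ℓ) * θS * rowConst261 (@geo9Y d ℓ hd hL b₀ b₁ Mstar) σ := by positivity
  refine ⟨max (max M₀ MT) ML, min a₀ (1 / (2 * ((1 + CLip d ℓ) * θS * rowConst261 (@geo9Y d ℓ hd hL b₀ b₁ Mstar) σ) + 1)), 2 * (1 + CLip d ℓ) * CR * A₀S * rowConst261 (@geo9Y d ℓ hd hL b₀ b₁ Mstar) σ,
    2 * (1 + CLip d ℓ) * (1 + CLip d ℓ) * CR * A₀S * rowConst261 (@geo9Y d ℓ hd hL b₀ b₁ Mstar) σ * rowConst261 (@geo9Y d ℓ hd hL b₀ b₁ Mstar) σ * θS,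
    lt_min ha₀ (by positivity), min_le_left _ _, by positivity, by positivity, fun x hM α₀ hα ha U hU hU' => ?_⟩
  have hM0 : M₀ ≤ (geo9Y x).M := (le_max_left _ _).trans ((le_max_left _ _).trans hM)
  have hMT : MT ≤ (geo9Y x).M := (le_max_right _ _).trans ((le_max_left _ _).trans hM)
  have hML : ML ≤ (geo9Y x).M := (le_max_right _ _).trans hM
  have ha' : (geo9Y x).M * α₀ ≤ a₀ := ha.trans (min_le_left _ _)
  have hMα : 0 ≤ (geo9Y x).M * α₀ := mul_nonneg (hM₀.trans hM0) hα.le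
  have hrowx : RowSum (toB6 (geo9Y x) 1 (H x)) σ (rowConst261 (@geo9Y d ℓ hd hL b₀ b₁ Mstar) σ) := fun y => hrow x hML y
  obtain ⟨h1, -, -, -⟩ := hST x hMT α₀ hα ha' U hU hU'
  obtain ⟨hstep, -, -, hPG0, -, hRd, hκ, Λ, hΛ, hdom⟩ := h1
  -- the smallness of the step over 𝔖₂ in the produced regime `Mα₀ ≤ aG`
  have hθ' : 0 ≤ θS * ((geo9Y x).M * α₀) := mul_nonneg hθS hMα
  have hq : (weightNorm (bXH x U) (rwt (geo9Y x) (-1)) (rwt_nonneg (fun y => (geo9Y_len_pos x y).le) (-1))).κ * (θS * ((geo9Y x).M * α₀)) * rowConst261 (@geo9Y d ℓ hd hL b₀ b₁ Mstar) σ ≤ 1 / 2 := by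
    have hκ' : (weightNorm (bXH x U) (rwt (geo9Y x) (-1)) (rwt_nonneg (fun y => (geo9Y_len_pos x y).le) (-1))).κ ≤ 1 + CLip d ℓ := hκ
    have e1 : (weightNorm (bXH x U) (rwt (geo9Y x) (-1)) (rwt_nonneg (fun y => (geo9Y_len_pos x y).le) (-1))).κ * (θS * ((geo9Y x).M * α₀)) * rowConst261 (@geo9Y d ℓ hd hL b₀ b₁ Mstar) σ = ((weightNorm (bXH x U) (rwt (geo9Y x) (-1)) (rwt_nonneg (fun y => (geo9Y_len_pos x y).le) (-1))).κ * (θS * rowConst261 (@geo9Y d ℓ hd hL b₀ b₁ Mstar) σ)) * ((geo9Y x).M * α₀) := by ring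
    have h1' : (weightNorm (bXH x U) (rwt (geo9Y x) (-1)) (rwt_nonneg (fun y => (geo9Y_len_pos x y).le) (-1))).κ * (θS * rowConst261 (@geo9Y d ℓ hd hL b₀ b₁ Mstar) σ) ≤ (1 + CLip d ℓ) * (θS * rowConst261 (@geo9Y d ℓ hd hL b₀ b₁ Mstar) σ) := mul_le_mul_of_nonneg_right hκ' (mul_nonneg hθS hc261)
    have h2' : ((weightNorm (bXH x U) (rwt (geo9Y x) (-1)) (rwt_nonneg (fun y => (geo9Y_len_pos x y).le) (-1))).κ * (θS * rowConst261 (@geo9Y d ℓ hd hL b₀ b₁ Mstar) σ)) * ((geo9Y x).M * α₀) ≤ ((1 + CLip d ℓ) * (θS * rowConst261 (@geo9Y d ℓ hd hL b₀ b₁ Mstar) σ)) * ((geo9Y x).M * α₀) := mul_le_mul_of_nonneg_right h1' hMα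
    have h3' : ((1 + CLip d ℓ) * (θS * rowConst261 (@geo9Y d ℓ hd hL b₀ b₁ Mstar) σ)) * ((geo9Y x).M * α₀) ≤ ((1 + CLip d ℓ) * (θS * rowConst261 (@geo9Y d ℓ hd hL b₀ b₁ Mstar) σ)) * (1 / (2 * ((1 + CLip d ℓ) * θS * rowConst261 (@geo9Y d ℓ hd hL b₀ b₁ Mstar) σ) + 1)) :=
      mul_le_mul_of_nonneg_left (ha.trans (min_le_right _ _)) (by positivity)
    have h4' : ((1 + CLip d ℓ) * (θS * rowConst261 (@geo9Y d ℓ hd hL b₀ b₁ Mstar) σ)) * (1 / (2 * ((1 + CLip d ℓ) * θS * rowConst261 (@geo9Y d ℓ hd hL b₀ b₁ Mstar) σ) + 1)) ≤ 1 / 2 := by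
      rw [show (1 + CLip d ℓ) * (θS * rowConst261 (@geo9Y d ℓ hd hL b₀ b₁ Mstar) σ) = (1 + CLip d ℓ) * θS * rowConst261 (@geo9Y d ℓ hd hL b₀ b₁ Mstar) σ by ring, mul_one_div,
        div_le_iff₀ (by positivity : (0 : ℝ) < 2 * ((1 + CLip d ℓ) * θS * rowConst261 (@geo9Y d ℓ hd hL b₀ b₁ Mstar) σ) + 1)]
      linarith
    rw [e1]; exact h2'.trans (h3'.trans h4')
  -- (3.42)₁ for G = G₀ + G₀Δ′_πG through the regular state (g28 `entry0_of_stepS_resolvent`), then the FLAT form by `(Lʲη)_a ≤ 1`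
  have hE := entry0_of_stepS_resolvent (hG x) (blk := (𝔬12 x).blk) (𝔖 := (weightNorm (bXH x U) (rwt (geo9Y x) (-1)) (rwt_nonneg (fun y => (geo9Y_len_pos x y).le) (-1))))
    (G0 := (𝔬12 x).G0 U) (S0 := (𝔬12 x).S0 U) (T := (𝔬12 x).Tpi U) (A := (𝔬12 x).G U)
    hrowx hc261 hσ.le hθ' hA₀S hCR hρG hρGP hρGP hρGK hstep.step hPG0 hRd hΛ hdom (hinvG0 x hM0 α₀ hα ha' U hU hU') (hinvG x hM0 α₀ hα ha' U hU hU') hq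
  refine ⟨?_, ?_⟩
  · refine hasMajorant_mono _ hE fun a b => ?_
    have hκ0 : 0 ≤ (weightNorm (bXH x U) (rwt (geo9Y x) (-1)) (rwt_nonneg (fun y => (geo9Y_len_pos x y).le) (-1))).κ := (weightNorm (bXH x U) (rwt (geo9Y x) (-1)) (rwt_nonneg (fun y => (geo9Y_len_pos x y).le) (-1))).κ_nonneg
    have hκ1 : (weightNorm (bXH x U) (rwt (geo9Y x) (-1)) (rwt_nonneg (fun y => (geo9Y_len_pos x y).le) (-1))).κ ≤ 1 + CLip d ℓ := hκ
    have hl2 : 0 ≤ (geo9Y x).len a ^ 2 := pow_nonneg (geo9Y_len_pos x a).le 2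
    have he : 0 ≤ Real.exp (-(ρG * (geo9Y x).dist a b)) := Real.exp_nonneg _
    have s2 : 2 * (weightNorm (bXH x U) (rwt (geo9Y x) (-1)) (rwt_nonneg (fun y => (geo9Y_len_pos x y).le) (-1))).κ * CR * A₀S * rowConst261 (@geo9Y d ℓ hd hL b₀ b₁ Mstar) σ ≤ 2 * (1 + CLip d ℓ) * CR * A₀S * rowConst261 (@geo9Y d ℓ hd hL b₀ b₁ Mstar) σ :=
      mul_le_mul_of_nonneg_right (mul_le_mul_of_nonneg_right (mul_le_mul_of_nonneg_right (mul_le_mul_of_nonneg_left hκ1 zero_le_two) hCR) hA₀S) hc261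
    exact mul_le_mul_of_nonneg_right (mul_le_mul_of_nonneg_right s2 hl2) he
  · -- the second (2.51) entry: `G − G₀ = (G₀Δ′_π)∘G`, composed INSIDE 𝔖₂ then read (n06-d g18 `hasMajorant_entries_of_stepS`, the G-half; Δ⁽²⁾-free)
    have htri : Triangle254 (toB6 (geo9Y x) 1 (H x)) := fun a b c => (hG x).tri a b c
    have hκ0 : 0 ≤ (weightNorm (bXH x U) (rwt (geo9Y x) (-1)) (rwt_nonneg (fun y => (geo9Y_len_pos x y).le) (-1))).κ := (weightNorm (bXH x U) (rwt (geo9Y x) (-1)) (rwt_nonneg (fun y => (geo9Y_len_pos x y).le) (-1))).κ_nonneg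
    have hκ1 : (weightNorm (bXH x U) (rwt (geo9Y x) (-1)) (rwt_nonneg (fun y => (geo9Y_len_pos x y).le) (-1))).κ ≤ 1 + CLip d ℓ := hκ
    have hq1 : (weightNorm (bXH x U) (rwt (geo9Y x) (-1)) (rwt_nonneg (fun y => (geo9Y_len_pos x y).le) (-1))).κ * (θS * ((geo9Y x).M * α₀)) * rowConst261 (@geo9Y d ℓ hd hL b₀ b₁ Mstar) σ < 1 := lt_of_le_of_lt hq (by norm_num)
    have hinv : (1 - (weightNorm (bXH x U) (rwt (geo9Y x) (-1)) (rwt_nonneg (fun y => (geo9Y_len_pos x y).le) (-1))).κ * (θS * ((geo9Y x).M * α₀)) * rowConst261 (@geo9Y d ℓ hd hL b₀ b₁ Mstar) σ)⁻¹ ≤ 2 := by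
      rw [inv_le_comm₀ (by linarith) (by norm_num)]; linarith
    have hinv0 : 0 ≤ (1 - (weightNorm (bXH x U) (rwt (geo9Y x) (-1)) (rwt_nonneg (fun y => (geo9Y_len_pos x y).le) (-1))).κ * (θS * ((geo9Y x).M * α₀)) * rowConst261 (@geo9Y d ℓ hd hL b₀ b₁ Mstar) σ)⁻¹ := inv_nonneg.mpr (by linarith)
    have hfix : (𝔬12 x).G U = (𝔬12 x).G0 U + (𝔬12 x).G0 U ∘ₗ (𝔬12 x).Tpi U ∘ₗ (𝔬12 x).G U :=
      fix_of_inverses (hinvG0 x hM0 α₀ hα ha' U hU hU') (hinvG x hM0 α₀ hα ha' U hU hU')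
    obtain ⟨Mc, hMc, hap⟩ := exists_hasMaj_const_of_dom (hG x) (𝔬12 x).blk (𝔬12 x).blk 0 hΛ hdom ((𝔬12 x).G U ∘ₗ LinearMap.id)
    have hP' : HasMaj (cNorm 1 (H x) (𝔬12 x).blk (hG x).lenle 0) (weightNorm (bXH x U) (rwt (geo9Y x) (-1)) (rwt_nonneg (fun y => (geo9Y_len_pos x y).le) (-1))) ((𝔬12 x).G0 U ∘ₗ LinearMap.id) (fun a b => A₀S * Real.exp (-(δP * (geo9Y x).dist a b))) := by
      rw [LinearMap.comp_id]; exact hPG0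
    have hEn := hasMaj_right_of_stepS (hG x) (A := (𝔬12 x).G U) (Fop := LinearMap.id) hrowx hθ' hA₀S hMc (ρ := ρG + σ) (by linarith) (by linarith : ρG + σ ≤ δP)
      (by linarith : ρG + σ + σ ≤ δK) hstep.step hP' hfix hap hq1
    have hA' : 0 ≤ A₀S * (1 - (weightNorm (bXH x U) (rwt (geo9Y x) (-1)) (rwt_nonneg (fun y => (geo9Y_len_pos x y).le) (-1))).κ * (θS * ((geo9Y x).M * α₀)) * rowConst261 (@geo9Y d ℓ hd hL b₀ b₁ Mstar) σ)⁻¹ := mul_nonneg hA₀S hinv0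
    have hsub : (𝔬12 x).G U - (𝔬12 x).G0 U = ((𝔬12 x).G0 U ∘ₗ (𝔬12 x).Tpi U) ∘ₗ ((𝔬12 x).G U ∘ₗ LinearMap.id) := by
      rw [LinearMap.comp_id]; conv_lhs => rw [hfix]
      rw [add_sub_cancel_left, LinearMap.comp_assoc]
    have hD := hasMaj_comp_exp (b₁ := cNorm 1 (H x) (𝔬12 x).blk (hG x).lenle 0) (b₂ := (weightNorm (bXH x U) (rwt (geo9Y x) (-1)) (rwt_nonneg (fun y => (geo9Y_len_pos x y).le) (-1)))) (b₃ := (weightNorm (bXH x U) (rwt (geo9Y x) (-1)) (rwt_nonneg (fun y => (geo9Y_len_pos x y).le) (-1))))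
      (T₁ := (𝔬12 x).G0 U ∘ₗ (𝔬12 x).Tpi U) (T₂ := (𝔬12 x).G U ∘ₗ LinearMap.id)
      htri (hG x).dnn hrowx hθ' hA' (by linarith : 0 ≤ ρG + σ) (le_rfl : ρG + σ ≤ ρG + σ) (by linarith : ρG + σ + σ ≤ δK) hstep.step hEn
    have hA'' : 0 ≤ (weightNorm (bXH x U) (rwt (geo9Y x) (-1)) (rwt_nonneg (fun y => (geo9Y_len_pos x y).le) (-1))).κ * (θS * ((geo9Y x).M * α₀)) * (A₀S * (1 - (weightNorm (bXH x U) (rwt (geo9Y x) (-1)) (rwt_nonneg (fun y => (geo9Y_len_pos x y).le) (-1))).κ * (θS * ((geo9Y x).M * α₀)) * rowConst261 (@geo9Y d ℓ hd hL b₀ b₁ Mstar) σ)⁻¹) * rowConst261 (@geo9Y d ℓ hd hL b₀ b₁ Mstar) σ := by positivity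
    have hRD := hasMaj_read_of_state (hG x) hrowx hA'' hCR hρG (by linarith : ρG ≤ ρG + σ) hρGP hD hRd
    rw [LinearMap.id_comp, ← hsub] at hRD
    have hCn' : 0 ≤ (weightNorm (bXH x U) (rwt (geo9Y x) (-1)) (rwt_nonneg (fun y => (geo9Y_len_pos x y).le) (-1))).κ * CR * ((weightNorm (bXH x U) (rwt (geo9Y x) (-1)) (rwt_nonneg (fun y => (geo9Y_len_pos x y).le) (-1))).κ * (θS * ((geo9Y x).M * α₀)) * (A₀S * (1 - (weightNorm (bXH x U) (rwt (geo9Y x) (-1)) (rwt_nonneg (fun y => (geo9Y_len_pos x y).le) (-1))).κ * (θS * ((geo9Y x).M * α₀)) * rowConst261 (@geo9Y d ℓ hd hL b₀ b₁ Mstar) σ)⁻¹) * rowConst261 (@geo9Y d ℓ hd hL b₀ b₁ Mstar) σ) * rowConst261 (@geo9Y d ℓ hd hL b₀ b₁ Mstar) σ := by positivity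
    have hDr := hasMajorant_of_read (hG x) hCn' hRD
    refine hasMajorant_mono (g := toB6 (geo9Y x) 1 (H x)) _ hDr fun a b => ?_
    have hk2 : (weightNorm (bXH x U) (rwt (geo9Y x) (-1)) (rwt_nonneg (fun y => (geo9Y_len_pos x y).le) (-1))).κ * CR * ((weightNorm (bXH x U) (rwt (geo9Y x) (-1)) (rwt_nonneg (fun y => (geo9Y_len_pos x y).le) (-1))).κ * (θS * ((geo9Y x).M * α₀)) * (A₀S * (1 - (weightNorm (bXH x U) (rwt (geo9Y x) (-1)) (rwt_nonneg (fun y => (geo9Y_len_pos x y).le) (-1))).κ * (θS * ((geo9Y x).M * α₀)) * rowConst261 (@geo9Y d ℓ hd hL b₀ b₁ Mstar) σ)⁻¹) * rowConst261 (@geo9Y d ℓ hd hL b₀ b₁ Mstar) σ) * rowConst261 (@geo9Y d ℓ hd hL b₀ b₁ Mstar) σ ≤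
        2 * (1 + CLip d ℓ) * (1 + CLip d ℓ) * CR * A₀S * rowConst261 (@geo9Y d ℓ hd hL b₀ b₁ Mstar) σ * rowConst261 (@geo9Y d ℓ hd hL b₀ b₁ Mstar) σ * θS * ((geo9Y x).M * α₀) := by
      have h1 : A₀S * (1 - (weightNorm (bXH x U) (rwt (geo9Y x) (-1)) (rwt_nonneg (fun y => (geo9Y_len_pos x y).le) (-1))).κ * (θS * ((geo9Y x).M * α₀)) * rowConst261 (@geo9Y d ℓ hd hL b₀ b₁ Mstar) σ)⁻¹ ≤ A₀S * 2 := mul_le_mul_of_nonneg_left hinv hA₀S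
      calc (weightNorm (bXH x U) (rwt (geo9Y x) (-1)) (rwt_nonneg (fun y => (geo9Y_len_pos x y).le) (-1))).κ * CR * ((weightNorm (bXH x U) (rwt (geo9Y x) (-1)) (rwt_nonneg (fun y => (geo9Y_len_pos x y).le) (-1))).κ * (θS * ((geo9Y x).M * α₀)) * (A₀S * (1 - (weightNorm (bXH x U) (rwt (geo9Y x) (-1)) (rwt_nonneg (fun y => (geo9Y_len_pos x y).le) (-1))).κ * (θS * ((geo9Y x).M * α₀)) * rowConst261 (@geo9Y d ℓ hd hL b₀ b₁ Mstar) σ)⁻¹) * rowConst261 (@geo9Y d ℓ hd hL b₀ b₁ Mstar) σ) * rowConst261 (@geo9Y d ℓ hd hL b₀ b₁ Mstar) σ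
          ≤ (1 + CLip d ℓ) * CR * ((1 + CLip d ℓ) * (θS * ((geo9Y x).M * α₀)) * (A₀S * 2) * rowConst261 (@geo9Y d ℓ hd hL b₀ b₁ Mstar) σ) * rowConst261 (@geo9Y d ℓ hd hL b₀ b₁ Mstar) σ := by gcongr
        _ = 2 * (1 + CLip d ℓ) * (1 + CLip d ℓ) * CR * A₀S * rowConst261 (@geo9Y d ℓ hd hL b₀ b₁ Mstar) σ * rowConst261 (@geo9Y d ℓ hd hL b₀ b₁ Mstar) σ * θS * ((geo9Y x).M * α₀) := by ring
    exact mul_le_mul_of_nonneg_right (mul_le_mul_of_nonneg_right hk2 (sq_nonneg _)) (Real.exp_nonneg _)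
end Summit.QuantumFields.YangMills.BalabanUVNodes.N06GDSupSubLegAtPinsPUWIPar

end
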